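import Summits.Ventures.CertifiedArithmetic.LowPrec.DoubleRoundingSqrtLowCore

/-!
# Double rounding of square roots below the underflow clause: THEOREM D-sqrt-U′ and LAW N-sqrt-U′

HONEST FRAMING: certified error envelopes and provably optimal rounding/accumulation schemes for
low-precision formats under stated cost models; every table by two implementations; no hardware or
vendor claims. "Square root in format `ψ`" is the correctly rounded square root of the record `ψ`
as a mathematical function (`roundNESqrt`, `RoundSqrt.lean`).

THE QUESTION. Clause (S) of THEOREM D-sqrt (`DoubleRoundingSqrt.lean`, `drSqrt_of_clause`):
`F_φ ⊆ F_ψ`, `P_ψ ≥ 2P_φ + 2`, `m_φ ≥ 1`, `L_ψ < L_φ` and the UNDERFLOW CLAUSE (U)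
`2 (L_ψ + P_ψ - 1) ≤ L_φ` (the root of the least positive value of `φ` is a normal number of `ψ`)
give `DRSqrt φ ψ`; (U) was not claimed sharp (DOUBLE-ROUNDING-SQRT.md §5). IN PRINT [Roux2014,
Def. 4, Thm 25, Table II] (Coq/Flocq, FLT formats = gradual underflow, no overflow; Flocq's
`emin` is the exponent of the least subnormal, our `L`, and `p = m + 1`): for radix 2,
`p₂ ≥ 2p₁ + 2` and
`emin₂ ≤ emin₁ - p₁ - 2 ∨ 2 emin₂ ≤ emin₁ - 4p₁ - 2` suffice. On records the second disjunct is (U)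
at `P_ψ = 2P_φ + 2`, and the FIRST reads `d := L_φ - L_ψ ≥ m_φ + 3` — a clause (S) did not carry.
This file (i) proves the first disjunct over the cell's finite saturating records (THEOREM
D-sqrt-U′: KNOWN in print, REPRODUCED here by an integer argument) and (ii) shows that it is
OPTIMAL IN THE EXPONENT (LAW N-sqrt-U′, this packet): one quantum-exponent short of it an explicit
operand fails, at every binade the source's grid and range allow.

THEOREM D-sqrt-U′ (`drSqrt_of_deep`, record-generic; = the first disjunct of [Roux2014, Table II]
read on records). `F_φ ⊆ F_ψ` (`embedsTest`), `P_ψ ≥ 2P_φ + 2`, `m_φ ≥ 1` and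
`quantum_φ = 2^d quantum_ψ` with DEPTH `d ≥ m_φ + 3` imply `DRSqrt φ ψ` — no hypothesis on biases,
ranges, or on where the normal range of `ψ` begins.
PROOF (`drSqrt_pos_low`, the anatomy of `drSqrt_pos` with one new branch). A slip makes
`fl_ψ (√a)` a midpoint `μ` of `φ`. If `μ` is a normal number of `ψ`, the integer heart
`sqrt_slip_core` of THEOREM D-sqrt applies verbatim (this is where `P_ψ ≥ 2P_φ + 2` enters). If
`μ` is SUBNORMAL in `ψ` — the case (U) excludes wholesale — write, in units of `ν = quantum_ψ/2`,
`μ = M ν`, `M = (2V+1) 2^G` with `V < 2^(m+1)` the significand of the lower neighbour and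
`G = g + d` (`g` = its binade in `φ`), and `a = Z ν²`, `Z = A 2^κ`, `A < 2^(m+1)`. Correct rounding
in `ψ` pins `(M-1)² ≤ Z ≤ (M+1)²`, `Z ≠ M²`; and `4^G ∣ Z` (for `g = 0` because the quantum of
`φ` is `2^d quantum_ψ = 2^(d+1) ν` and `2^(d+1+W) ν² = quantum_φ` forces `κ ≥ 2d + 1`; for
`g ≥ 1` from `2^m ≤ V` and sizes). Hence `4^G ∣ Z - M² ≠ 0`, so `4^G ≤ |Z - M²| ≤ 2M + 1 <
2^(m+3+G)`: `G ≤ m + 2` (`sqrt_low_core`), contradicting `d ≥ m + 3`.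

LAW N-sqrt-U′ (`not_drSqrt_low_strip`, THE DEPTH IS ATTAINED, record-generic; this packet). For
`quantum_φ = 2^d quantum_ψ`, `d ≥ 1`, nested ranges, `1 ≤ m_φ < m_ψ` and a binade `g ≥ 0` with
`g + d ≤ m + 2`, the midpoint `μ = (2^(m+2) - 1) 2^g quantum_φ/2` and the operand
`a = μ² - 4^g quantum_φ²/4 = (2^(m+1) - 1) 2^(2g+m+1+L_φ)` quanta (on the grid iff
`bias_φ ≤ 2g + 2`; operand and `2^(m+1+g)` quanta in range) satisfy
`(μ - quantum_ψ/2)² < a < μ²`, so `fl_ψ (√a) = μ` (`ψ`'s surrogate root is `μ - quantum_ψ/4` and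
every value of `ψ` is a multiple of `quantum_ψ`, `toRat_roundNE_of_abs_lt_half`) while
`fl_φ (μ) = 2^(m+1+g)` quanta (a tie above an odd significand: `toRat_roundNE_gmid_odd`, and in
the finest zone the new `toRat_roundNE_fine_mid_odd`) `≠ (2^(m+1) - 1) 2^g` quanta `= fl_φ (√a)`
(`not_drSqrt_of_fine_mid_below`). COROLLARY (`drSqrt_iff_deep`): for sources of bias `≤ 2`
(e2m1, e2m3) `DRSqrt φ ψ ↔ d ≥ m_φ + 3` exactly; for bias `b ≥ 3` the family needs
`g ≥ ⌈(b-2)/2⌉` and refutes every `d ≤ m + 2 - ⌈(b-2)/2⌉` (`not_drSqrt_of_shallow`); in between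
(e.g. e3m2, bias 3, `d = 4`) neither statement applies and the toy cell is decided by exhaustion.

TABLE (implementation B, §6; implementation A `code/enum/sqrt_underflow_law.py`, certificate
`certs/enum/DOUBLE-ROUNDING-SQRT-UNDERFLOW.json`): the 28 toy pairs of DOUBLE-ROUNDING-SQRT.md §5
— e2m1 → ⟨5,b,12,31⟩, e2m3 → ⟨9,b,14,511⟩, e3m2 → ⟨7,b,14,127⟩ — with `(d, F_X ⊆ F_Y, (U), depth
test, shallow test, DRSqrt by exhaustion)` per pair by `decide +kernel` (`sqrtToyPairs_table`):
depth test 24, (U) 22, shallow 2 = the failing pairs, innocuous 26; readings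
`drSqrt_E2M3_toy9_iff` (`DRSqrt e2m3 ⟨9,b,14,511⟩ ↔ b ≥ 1` for `b ≤ 12`), `drSqrt_E2M1_toy5_iff`.

FILE MAP. §1 `sqrt_low_core`; §2 `toRat_roundNE_of_abs_lt_half`, `toRat_roundNE_fine_mid_odd`;
§3 `drSqrt_pos_low`, `drSqrt_of_low` ((U) ∨ (U′)), `drSqrt_of_deep`; §4
`not_drSqrt_of_fine_mid_below`, `not_drSqrt_low_strip`; §5 `not_drSqrt_of_shallow`,
`drSqrt_iff_deep`, tests `drSqrtDeepTest` / `drSqrtShallowTest` / `drSqrtShallowAny` with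
soundness; §6 toy records, `sqrtToyPairs_table`, `sqrtToyPairs_counts`, readings. No `sorry`, no
`native_decide`; tables by `decide +kernel`.

KNOWN / REPRODUCED / NEW. KNOWN: innocuous double rounding of `√` for `p₂ ≥ 2p₁ + 2` with
unbounded exponents [Figueroa1995, §3], optimal in the precision [Roux2014, Rem. 26]; with gradual
underflow under `emin₂ ≤ emin₁ - p₁ - 2 ∨ 2emin₂ ≤ emin₁ - 4p₁ - 2` [Roux2014, Thm 25 with
`double_round_sqrt_FLT`, Table II] (Coq/Flocq) — the first disjunct IS the depth clause; Roux's
optimality remarks concern the precision bounds only. REPRODUCED: the depth clause over finite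
saturating records with subnormals and ties-to-even, in Lean 4, by the integer heart
`4^G ∣ Z - M²` (a different argument and system). NEW as far as searched
(pub-lowprec-enum/FRESHNESS-ENUM.md gen34, labelled corpus + galaxy queries): the failure family one
quantum-exponent short of the clause at every admissible binade (optimality of the first disjunct
in the exponent — the Table II analogue of [Roux2014, Rem. 26]), the exact threshold
`DRSqrt ↔ d ≥ m_φ + 3` for sources of bias `≤ 2`, and the kernel-checked toy table.
-/

namespace Summit.Ventures.CertifiedArithmetic

open Literature.ComputerArithmetic.FloatingPoint
open Literature.ComputerArithmetic.FloatingPoint.Format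
open Literature.ComputerArithmetic.FloatingPoint.MiniFloat

/-! ## §3 The anatomy of a slip, the midpoint normal OR subnormal in `ψ` -/

/-- THEOREM D-sqrt-U′, positive operands, STATED ON THE SURROGATE (supersedes `drSqrt_pos`, whose
anatomy it repeats up to the exponent of the midpoint). Records `F_φ ⊆ F_ψ` (`embedsTest`),
`P_ψ ≥ 2P_φ + 2`, `m_φ ≥ 1`, `L_ψ < L_φ`, and EITHER the underflow clause (U)
`2 (L_ψ + P_ψ - 1) ≤ L_φ` of `drSqrt_pos` OR the depth clause (U′) `L_ψ + m_φ + 3 ≤ L_φ`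
(`quantum_φ = 2^d quantum_ψ` with `d ≥ m_φ + 3`): if `x` is the half-quantum surrogate of `√a`
in `ψ` then `fl_φ (fl_ψ x) = fl_φ x`. A slip makes `fl_ψ x` a midpoint `m` of `φ`; if `m` is a
normal number of `ψ` the integer heart `sqrt_slip_core` of THEOREM D-sqrt refutes it (this is
where `P_ψ ≥ 2P_φ + 2` is used; under (U) `m` is always normal); if `m` is subnormal in `ψ`
(`|x - m| ≤ quantum_ψ / 2`) the heart `sqrt_low_core` gives `g + d ≤ m_φ + 2` for the binade `g`
of `m` in `φ`, contradicting (U′). [this packet; cite: Figueroa1995; Roux2014, Thm 25] -/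
theorem drSqrt_pos_low {φ ψ : Format} (hE : embedsTest φ ψ = true)
    (hm : 2 * φ.manBits + 3 ≤ ψ.manBits)
    (hU : 2 * (ψ.qexp + ψ.manBits) ≤ φ.qexp ∨ ψ.qexp + φ.manBits + 3 ≤ φ.qexp)
    (h1 : 1 ≤ φ.manBits) (hq1 : ψ.qexp + 1 ≤ φ.qexp) {a : MiniFloat φ} (ha : 0 < a.toRat)
    {x : ℚ} {n : ℕ}
    (hxn : (x = n * (ψ.quantum / 2) ∧ ((n : ℚ) * (ψ.quantum / 2)) ^ 2 = a.toRat) ∨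
      (x = ((n : ℚ) + 1 / 2) * (ψ.quantum / 2) ∧ ((n : ℚ) * (ψ.quantum / 2)) ^ 2 < a.toRat ∧
        a.toRat < (((n : ℚ) + 1) * (ψ.quantum / 2)) ^ 2)) :
    (roundNE φ (roundNE ψ x).toRat).toRat = (roundNE φ x).toRat := by
  by_contra h
  have hQφ := φ.quantum_pos; have hQ := ψ.quantum_pos
  set ν : ℚ := ψ.quantum / 2 with hνdef
  have hν : 0 < ν := by positivity
  have hx : 0 < x := by
    rcases hxn with ⟨hx, hsq⟩ | ⟨hx, -, -⟩
    · rw [hx]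
      rcases (show (0:ℚ) ≤ n * ν by positivity).eq_or_lt with h0 | h0
      · rw [← h0] at hsq; simp at hsq; linarith
      · exact h0
    · rw [hx]; positivity
  have hq : ψ.qexp ≤ φ.qexp := by omega
  obtain ⟨zM, hzM⟩ := exists_toRat_eq_maxRat_of_test hE
  have hmax : φ.maxRat ≤ ψ.maxRat := hzM ▸ (le_abs_self _).trans (abs_toRat_le_maxRat zM)
  -- the slip anatomy in `φ`: `fl_ψ x = m = (v+u)/2`, `u = v + G`
  obtain ⟨v, u, hv0, hvx, hxu, hgap, hmid, hxm⟩ :=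
    slip_midpoint_of_pos_of_qexp_lt (by omega) hq1 hmax hx h
  set y := roundNE ψ x with hydef
  obtain ⟨u', hu'⟩ := exists_toRat_eq_add_ulp hv0 (hvx.trans hxu)
  have hule := add_ulp_le_of_lt hv0 (hvx.trans hxu)
  have hGpos : (0:ℚ) < 2 ^ (v.expCode - 1) * φ.quantum := by positivity
  have hueq : u.toRat = v.toRat + 2 ^ (v.expCode - 1) * φ.quantum := by
    rcases hgap u' with h1 | h1 <;> linarith
  have hutop : u.toRat ≤ 2 ^ (φ.manBits + 1 + (v.expCode - 1)) * φ.quantum :=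
    hueq ▸ toRat_add_ulp_le hv0
  have hyu : y.toRat < u.toRat := by rw [hmid]; linarith
  have hy0 : 0 < y.toRat := by rw [hmid]; linarith
  -- quanta: `quantum φ = 2^D quantum ψ`, `quantum ψ = 2 ν`, `2^W ν = 1`
  set D := (φ.qexp - ψ.qexp).toNat with hDdef
  have hDq : φ.quantum = 2 ^ D * ψ.quantum := quantum_eq_two_pow_mul hq
  have hD0 : ((D : ℕ) : ℤ) = φ.qexp - ψ.qexp := Int.toNat_of_nonneg (by omega)
  have hQν : ψ.quantum = 2 * ν := by rw [hνdef]; ring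
  have hqφ1 : φ.qexp ≤ 1 := by unfold Format.qexp; omega
  have hqψ1 : ψ.qexp ≤ 1 := by omega
  set W := (1 - ψ.qexp).toNat with hWdef
  have hW0 : ((W : ℕ) : ℤ) = 1 - ψ.qexp := Int.toNat_of_nonneg (by omega)
  have hWν : (2:ℚ) ^ W * ν = 1 := by
    rw [hνdef]; unfold Format.quantum
    rw [← zpow_natCast, hW0, mul_div_assoc', ← zpow_add₀ two_ne_zero, sub_add_cancel, zpow_one,
      div_self two_ne_zero]
  -- the midpoint in units of `ν`: `m = M ν`, `M = (2V'+1) 2^g`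
  have hyQ : y.toRat = (y.scaledMag : ℚ) * ψ.quantum := by
    rw [toRat_eq_toInt_mul, toInt_eq_scaledMag_of_nonneg hy0.le]; push_cast; rfl
  have hvQ : v.toRat = (v.scaledMag : ℚ) * φ.quantum := by
    rw [toRat_eq_toInt_mul, toInt_eq_scaledMag_of_nonneg hv0]; push_cast; rfl
  obtain ⟨V', hV'⟩ := pow_ulpExp_dvd_scaledMag v
  set g := (v.expCode - 1) + D with hgdef
  set M : ℤ := 2 * (y.scaledMag : ℤ) with hMdef
  have hmν : y.toRat = (M : ℚ) * ν := by rw [hyQ, hMdef, hQν]; push_cast; ring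
  have hGν : 2 ^ (v.expCode - 1) * φ.quantum = 2 * (2:ℚ) ^ g * ν := by
    rw [hDq, hQν, hgdef, pow_add]; ring
  have hMg : M = (2 * (V' : ℤ) + 1) * 2 ^ g := by
    have h1 : (M : ℚ) * ν = ((2 * (V' : ℤ) + 1) * 2 ^ g : ℤ) * ν := by
      rw [← hmν, hmid, hueq, hvQ, hV', hGν, hDq, hQν, hgdef]
      push_cast; ring
    exact_mod_cast mul_right_cancel₀ (ne_of_gt hν) h1
  -- the significand `V'` of the lower neighbour: `V' < 2^(m_φ+1)`; `2^m_φ ≤ V'` if `v` is normal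
  have hV'hi : (V' : ℤ) < 2 ^ (φ.manBits + 1) := by
    have h1 := scaledMag_lt_pow_ulpExp v
    rw [hV', pow_add, mul_comm (2 ^ (φ.manBits + 1))] at h1
    exact_mod_cast Nat.lt_of_mul_lt_mul_left h1
  -- (a) correct rounding in `ψ`: `|x - m| ≤ 2^t ν`
  set t := y.expCode - 1 with htdef
  have hyz : y.toRat < zM.toRat := by
    rw [hzM]; exact hyu.trans_le ((le_abs_self _).trans (abs_toRat_le_maxRat u))
  have habs : |x - y.toRat| ≤ 2 ^ t * ν := by
    have := abs_sub_roundNE_le_half_ulp_of_pos hy0 hyz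
    rw [← hydef, hQν] at this; convert this using 1; rw [htdef]; ring
  -- (b) `M < 2^(P_φ + g + 1)`
  have hMlt : M < (2:ℤ) ^ (φ.manBits + 1 + g + 1) := by
    have h1 : (M : ℚ) * ν < (2:ℚ) ^ (φ.manBits + 1 + g + 1) * ν := by
      rw [← hmν]
      calc y.toRat < u.toRat := hyu
        _ ≤ 2 ^ (φ.manBits + 1 + (v.expCode - 1)) * φ.quantum := hutop
        _ = (2:ℚ) ^ (φ.manBits + 1 + g + 1) * ν := by
            rw [hDq, hQν, hgdef]; simp only [pow_add, pow_one]; ring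
    exact_mod_cast lt_of_mul_lt_mul_right h1 hν.le
  -- (c) `2^t ≤ M` (for a subnormal midpoint `t = 0` and `M ≥ 2`)
  have hyS1 : 1 ≤ y.scaledMag := by
    by_contra h0
    have : y.scaledMag = 0 := by omega
    rw [hyQ, this] at hy0; simp at hy0
  have hMt : (2:ℤ) ^ t ≤ M := by
    rcases Nat.lt_or_ge y.expCode 1 with hE0 | hE1
    · have ht0 : t = 0 := by rw [htdef]; omega
      rw [ht0, pow_zero, hMdef]
      have : (1:ℤ) ≤ y.scaledMag := by exact_mod_cast hyS1
      linarith
    · have hSlo : 2 ^ (ψ.manBits + t) ≤ y.scaledMag := pow_le_scaledMag_of_expCode_pos y hE1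
      have h1 : ((2 ^ (ψ.manBits + t) : ℕ) : ℤ) ≤ y.scaledMag := by exact_mod_cast hSlo
      push_cast at h1
      rw [hMdef]
      have h2 : (2:ℤ) ^ t ≤ 2 ^ (ψ.manBits + t) := pow_le_pow_right₀ (by norm_num) (by omega)
      have h3 : (0:ℤ) ≤ y.scaledMag := by positivity
      linarith
  have hM0 : (0:ℤ) ≤ M := le_trans (by positivity) hMt
  -- (d) the operand: `a = Z ν²`, `Z = A₁ 2^κ`, `A₁ < 2^P_φ` odd
  have haS : a.scaledMag ≠ 0 := by
    intro h0; rw [toRat_eq_toInt_mul, toInt_eq_scaledMag_of_nonneg ha.le, h0] at ha; simp at ha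
  obtain ⟨α, A₁, hA₁, hAα, hA₁lt⟩ := exists_odd_part a haS
  set κ := α + D + 1 + W with hκdef
  set Z : ℤ := (A₁ : ℤ) * 2 ^ κ with hZdef
  have hZq : a.toRat = (Z : ℚ) * ν ^ 2 := by
    rw [toRat_eq_toInt_mul, toInt_eq_scaledMag_of_nonneg ha.le, hAα, hZdef, hκdef, hDq, hQν]
    push_cast
    calc ((2:ℚ) ^ α * A₁) * (2 ^ D * (2 * ν)) = 2 ^ α * A₁ * 2 ^ D * 2 * ν * (2 ^ W * ν) := by
          rw [hWν, mul_one]; ring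
      _ = A₁ * 2 ^ (α + D + 1 + W) * ν ^ 2 := by simp only [pow_add, pow_one]; ring
  have hA' : (A₁ : ℤ) < 2 ^ (φ.manBits + 1) := by exact_mod_cast hA₁lt
  -- (e) the surrogate pins `Z` against `M`
  have hlo : ((M : ℚ) - 2 ^ t) * ν ≤ x := by have := (abs_le.mp habs).1; rw [hmν] at this; linarith
  have hhi : x ≤ ((M : ℚ) + 2 ^ t) * ν := by have := (abs_le.mp habs).2; rw [hmν] at this; linarith
  have hMt' : (0:ℤ) ≤ M - 2 ^ t := by linarith
  have key : (M - 2 ^ t) ^ 2 ≤ Z ∧ Z ≤ (M + 2 ^ t) ^ 2 ∧ Z ≠ M ^ 2 := by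
    rcases hxn with ⟨hx1, hsq⟩ | ⟨hx1, hsqlo, hsqhi⟩
    · -- exact root `x = n ν`, `Z = n²`
      have hZn : Z = (n : ℤ) ^ 2 := by
        have e : ((n : ℚ) * ν) ^ 2 = ((n : ℤ) ^ 2 : ℤ) * ν ^ 2 := by push_cast; ring
        rw [hZq, e] at hsq
        exact_mod_cast (mul_right_cancel₀ (by positivity) hsq).symm
      have h1 : M - 2 ^ t ≤ (n : ℤ) := by
        have : ((M - 2 ^ t : ℤ) : ℚ) * ν ≤ (n : ℚ) * ν := by push_cast; rw [← hx1]; exact hlo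
        exact_mod_cast le_of_mul_le_mul_right this hν
      have h2 : (n : ℤ) ≤ M + 2 ^ t := by
        have : (n : ℚ) * ν ≤ ((M + 2 ^ t : ℤ) : ℚ) * ν := by push_cast; rw [← hx1]; exact hhi
        exact_mod_cast le_of_mul_le_mul_right this hν
      refine ⟨by rw [hZn]; exact pow_le_pow_left₀ hMt' h1 2,
        by rw [hZn]; exact pow_le_pow_left₀ (by positivity) h2 2, fun hZM => hxm ?_⟩
      have hnM : (n : ℤ) = M := by
        have := hZn.symm.trans hZM
        exact (pow_left_inj₀ (by positivity) hM0 two_ne_zero).mp this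
      rw [hx1, hmν, ← hnM]; norm_cast
    · -- midpoint `x = (n + ½) ν`, `n² < Z < (n+1)²`
      have hZlo' : (n : ℤ) ^ 2 < Z := by
        have : (((n : ℤ) ^ 2 : ℤ) : ℚ) * ν ^ 2 < (Z : ℚ) * ν ^ 2 := by
          rw [← hZq]; push_cast; rw [← mul_pow]; exact hsqlo
        exact_mod_cast lt_of_mul_lt_mul_right this (by positivity)
      have hZhi' : Z < ((n : ℤ) + 1) ^ 2 := by
        have : (Z : ℚ) * ν ^ 2 < ((((n : ℤ) + 1) ^ 2 : ℤ) : ℚ) * ν ^ 2 := by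
          rw [← hZq]; push_cast; rw [← mul_pow]; exact hsqhi
        exact_mod_cast lt_of_mul_lt_mul_right this (by positivity)
      have h1 : M - 2 ^ t ≤ (n : ℤ) := by
        by_contra hc
        have hc' : ((n : ℤ) : ℚ) + 1 ≤ ((M - 2 ^ t : ℤ) : ℚ) := by
          exact_mod_cast (show (n:ℤ) + 1 ≤ M - 2 ^ t by omega)
        push_cast at hc'
        rw [hx1] at hlo; have := mul_le_mul_of_nonneg_right hc' hν.le; linarith
      have h2 : (n : ℤ) + 1 ≤ M + 2 ^ t := by
        by_contra hc
        have hc' : ((M + 2 ^ t : ℤ) : ℚ) ≤ (n : ℚ) := by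
          exact_mod_cast (show M + 2 ^ t ≤ (n:ℤ) by omega)
        push_cast at hc'
        rw [hx1] at hhi; have := mul_le_mul_of_nonneg_right hc' hν.le; linarith
      refine ⟨(pow_le_pow_left₀ hMt' h1 2).trans hZlo'.le,
        hZhi'.le.trans (pow_le_pow_left₀ (by positivity) h2 2), fun hZM => ?_⟩
      rw [hZM] at hZlo' hZhi'
      have h3 : (n : ℤ) < M := lt_of_pow_lt_pow_left₀ 2 hM0 hZlo'
      have h4 : M < (n : ℤ) + 1 := lt_of_pow_lt_pow_left₀ 2 (by positivity) hZhi'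
      omega
  obtain ⟨hZlo, hZhi, hne⟩ := key
  -- (f) the midpoint `m = fl_ψ x` is normal in `ψ`, or subnormal
  rcases Nat.lt_or_ge y.expCode 1 with hE0 | hE1
  · -- SUBNORMAL midpoint: `t = 0`
    have ht0 : t = 0 := by rw [htdef]; omega
    rw [ht0, pow_zero] at hZlo hZhi
    rcases hU with hU | hd
    · -- under (U) the surrogate lies above the least normal number of `ψ`: impossible
      have hUn : 2 * ψ.manBits + 2 ≤ D + 1 + W := by omega
      have haq : φ.quantum ≤ a.toRat := by
        have h1' : (1:ℚ) ≤ a.scaledMag := by exact_mod_cast Nat.pos_of_ne_zero haS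
        rw [toRat_eq_toInt_mul, toInt_eq_scaledMag_of_nonneg ha.le]; push_cast
        exact le_mul_of_one_le_left hQφ.le h1'
      have hnsq : ((2:ℚ) ^ (ψ.manBits + 1) * ν) ^ 2 ≤ a.toRat := by
        have e1 : ((2:ℚ) ^ (ψ.manBits + 1) * ν) ^ 2 = 2 ^ (2 * ψ.manBits + 2) * ν * ν := by ring
        have e2 : φ.quantum = 2 ^ (D + 1 + W) * ν * ν := by
          rw [hDq, hQν, pow_add, pow_add, pow_one]
          calc (2:ℚ) ^ D * (2 * ν) = 2 ^ D * 2 * ν * (2 ^ W * ν) := by rw [hWν]; ring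
            _ = 2 ^ D * 2 * 2 ^ W * ν * ν := by ring
        have e3 : (2:ℚ) ^ (2 * ψ.manBits + 2) ≤ 2 ^ (D + 1 + W) :=
          pow_le_pow_right₀ (by norm_num) hUn
        rw [e1]; rw [e2] at haq
        exact (mul_le_mul_of_nonneg_right (mul_le_mul_of_nonneg_right e3 hν.le) hν.le).trans haq
      have hnx : (2:ℚ) ^ (ψ.manBits + 1) * ν ≤ x := by
        have hlt : ((2:ℚ) ^ (ψ.manBits + 1) * ν) ^ 2 < (((n : ℚ) + 1) * ν) ^ 2 := by
          rcases hxn with ⟨-, hsq⟩ | ⟨-, -, hhi'⟩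
          · have hn0 : (0:ℚ) ≤ n := by positivity
            have : ((n : ℚ) * ν) ^ 2 < (((n : ℚ) + 1) * ν) ^ 2 :=
              pow_lt_pow_left₀ (mul_lt_mul_of_pos_right (by linarith) hν) (by positivity)
                two_ne_zero
            linarith
          · exact hnsq.trans_lt hhi'
        have h2 : (2:ℚ) ^ (ψ.manBits + 1) * ν < ((n : ℚ) + 1) * ν :=
          lt_of_pow_lt_pow_left₀ 2 (by positivity) hlt
        have h3 : ((2 ^ (ψ.manBits + 1) : ℕ) : ℚ) < n + 1 := by
          push_cast; exact lt_of_mul_lt_mul_right h2 hν.le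
        have h4 : 2 ^ (ψ.manBits + 1) ≤ n := by
          have : 2 ^ (ψ.manBits + 1) < n + 1 := by exact_mod_cast h3
          omega
        have h5 : (2:ℚ) ^ (ψ.manBits + 1) ≤ n := by exact_mod_cast h4
        rcases hxn with ⟨hx1, -⟩ | ⟨hx1, -, -⟩ <;> rw [hx1] <;>
          exact mul_le_mul_of_nonneg_right (by linarith) hν.le
      have hS : y.scaledMag < 2 ^ ψ.manBits := by
        by_contra hS
        have h0 : y.expCode = 0 := by omega
        have h' := not_lt.mp hS
        have := y.man_lt
        unfold MiniFloat.scaledMag Format.scaled at h'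
        rw [if_pos h0] at h'
        omega
      obtain ⟨w, hw⟩ := exists_toRat_eq_add_ulp hy0.le hyz
      have hwe : w.toRat = y.toRat + ψ.quantum := by
        rw [hw, show y.expCode - 1 = 0 by omega, pow_zero, one_mul]
      have hwx : w.toRat ≤ x := by
        have hS' : (y.scaledMag : ℚ) + 1 ≤ 2 ^ ψ.manBits := by exact_mod_cast hS
        calc w.toRat = ((y.scaledMag : ℚ) + 1) * ψ.quantum := by rw [hwe, hyQ]; ring
          _ ≤ 2 ^ ψ.manBits * ψ.quantum := mul_le_mul_of_nonneg_right hS' hQ.le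
          _ = (2:ℚ) ^ (ψ.manBits + 1) * ν := by rw [hQν, pow_succ]; ring
          _ ≤ x := hnx
      have hmono := toRat_roundNE_mono (φ := ψ) hwx
      rw [toRat_roundNE_toRat, ← hydef] at hmono
      linarith
    · -- under (U′): the integer heart `sqrt_low_core` bounds the binade of the midpoint
      have hκV : 2 * g ≤ κ ∨ 2 ^ φ.manBits ≤ V' := by
        rcases Nat.lt_or_ge v.expCode 1 with hv0' | hv1
        · left
          have : v.expCode - 1 = 0 := by omega
          rw [hgdef, hκdef, this]; omega
        · right
          have h1' := pow_le_scaledMag_of_expCode_pos v hv1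
          rw [hV', pow_add, mul_comm (2 ^ φ.manBits)] at h1'
          exact Nat.le_of_mul_le_mul_left h1' (Nat.pos_of_ne_zero (by positivity))
      have hG := sqrt_low_core (m := φ.manBits) hA' hV'hi hMg hκV hZlo hZhi hne
      rw [hgdef] at hG
      omega
  · -- NORMAL midpoint: the anatomy of THEOREM D-sqrt
    have hSlo : 2 ^ (ψ.manBits + t) ≤ y.scaledMag := pow_le_scaledMag_of_expCode_pos y hE1
    have hShi : y.scaledMag < 2 ^ (ψ.manBits + 1 + t) := scaledMag_lt_pow_ulpExp y
    obtain ⟨Y', hY'⟩ := pow_ulpExp_dvd_scaledMag y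
    obtain ⟨d, hd⟩ : ∃ d, ψ.manBits = d + 1 := ⟨ψ.manBits - 1, by omega⟩
    have hMlo : (2:ℤ) ^ (d + t + 2) ≤ M := by
      have h1 : ((2 ^ (ψ.manBits + t) : ℕ) : ℤ) ≤ y.scaledMag := by exact_mod_cast hSlo
      push_cast at h1
      rw [hMdef, show d + t + 2 = (ψ.manBits + t) + 1 by omega, pow_succ]; linarith
    have hMhi : M < (2:ℤ) ^ (d + t + 3) := by
      have h1 : (y.scaledMag : ℤ) < ((2 ^ (ψ.manBits + 1 + t) : ℕ) : ℤ) := by exact_mod_cast hShi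
      push_cast at h1
      rw [hMdef, show d + t + 3 = (ψ.manBits + 1 + t) + 1 by omega, pow_succ]; linarith
    have hdvd : (2:ℤ) ^ (t + 1) ∣ M := ⟨Y', by rw [hMdef, hY', htdef, pow_succ]; push_cast; ring⟩
    exact sqrt_slip_core (P := φ.manBits + 1) (d := d) hA' (by omega) hMg hMlo hMhi hMlt hdvd
      hZlo hZhi hne

/-- THEOREM D-sqrt-U′ AS `DRSqrt`: under `F_φ ⊆ F_ψ`, `P_ψ ≥ 2P_φ + 2`, `m_φ ≥ 1`, `L_ψ < L_φ` and
(U) or (U′), ONE square root in `ψ` converted to `φ` is the correctly rounded square root of `φ`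
(the surrogate argument of `drSqrt_of_clause`, on `drSqrt_pos_low`). [this packet] -/
theorem drSqrt_of_low {φ ψ : Format} (hE : embedsTest φ ψ = true)
    (hm : 2 * φ.manBits + 3 ≤ ψ.manBits)
    (hU : 2 * (ψ.qexp + ψ.manBits) ≤ φ.qexp ∨ ψ.qexp + φ.manBits + 3 ≤ φ.qexp)
    (h1 : 1 ≤ φ.manBits) (hq1 : ψ.qexp + 1 ≤ φ.qexp) : DRSqrt φ ψ := fun a ha => by
  rw [← toRat_roundNE_sqrtSurr (show ψ.qexp ≤ φ.qexp by omega) ha]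
  show (roundNE φ (roundNE ψ (sqrtSurr ψ a.toRat)).toRat).toRat = _
  rcases ha.eq_or_lt with h0 | hpos
  · rw [← h0, sqrtSurr_zero, toRat_roundNE_zero]
  · by_cases hex : ((sqrtCell ψ a.toRat : ℚ) * (ψ.quantum / 2)) ^ 2 = a.toRat
    · exact drSqrt_pos_low hE hm hU h1 hq1 hpos (n := sqrtCell ψ a.toRat)
        (Or.inl ⟨sqrtSurr_of_sq_eq hex, hex⟩)
    · exact drSqrt_pos_low hE hm hU h1 hq1 hpos (n := sqrtCell ψ a.toRat)
        (Or.inr ⟨sqrtSurr_of_sq_ne hex, (sqrtCell_sq_le ha).lt_of_ne hex, lt_sqrtCell_succ_sq _⟩)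

/-- THEOREM D-sqrt-U′ (THE DEPTH CLAUSE): for records `F_φ ⊆ F_ψ` with `P_ψ ≥ 2P_φ + 2`, `m_φ ≥ 1`
and `quantum_φ = 2^d quantum_ψ` with `d ≥ m_φ + 3` — NO hypothesis on the biases, the ranges or
where the least normal number of `ψ` lies — `DRSqrt φ ψ`. This is the first disjunct
`emin_ψ ≤ emin_φ - P_φ - 2` of the conditions in print for gradual underflow (Flocq `emin` = our
`L`), KNOWN and Coq-checked there for FLT formats; reproduced here over finite saturating records.
The depth `m_φ + 3` is attained (`not_drSqrt_low_strip`: at `d = m_φ + 2` for every source of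
bias `≤ 2` with range; this packet). [cite: Roux2014, Thm 25, Table II; Figueroa1995] -/
theorem drSqrt_of_deep {φ ψ : Format} (hE : embedsTest φ ψ = true)
    (hm : 2 * φ.manBits + 3 ≤ ψ.manBits) (h1 : 1 ≤ φ.manBits)
    (hd : ψ.qexp + φ.manBits + 3 ≤ φ.qexp) : DRSqrt φ ψ :=
  drSqrt_of_low hE hm (Or.inr hd) h1 (by omega)

/-- Parameter test of THEOREM D-sqrt-U′ (the depth clause = [Roux2014, Table II] disjunct 1). -/
def drSqrtDeepTest (φ ψ : Format) : Bool :=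
  embedsTest φ ψ && decide (2 * φ.manBits + 3 ≤ ψ.manBits) && decide (1 ≤ φ.manBits) &&
    decide (ψ.qexp + φ.manBits + 3 ≤ φ.qexp)

/-- Soundness of the depth test. -/
theorem drSqrt_of_deepTest {φ ψ : Format} (h : drSqrtDeepTest φ ψ = true) : DRSqrt φ ψ := by
  simp only [drSqrtDeepTest, Bool.and_eq_true, decide_eq_true_eq] at h
  obtain ⟨⟨⟨hE, hm⟩, h1⟩, hd⟩ := h
  exact drSqrt_of_deep hE hm h1 hd

end Summit.Ventures.CertifiedArithmetic
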